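import Summits.AnomalousDissipation.AnomalousDissipation.Theorems.ScalarAnomalySteadySourceFormal.Negative.ShearModes

/-!
# Negative knowledge for the crux `ScalarAnomalySteadySourceFormal` (stmt-AnomalousDissipation-0448), VII-b:
# continuous (indeed `C¹`) representatives of the scalar modes under trigonometric-polynomial stirring

Certified copy of §9.2 of the cdisprove work file.  For a global weak solution `θ` of the crux's
forced class stirred by `u(t) = realTrigPoly S (c t)` with continuous bounded coefficient paths,
the modal integral equation (`Negative.ShearModes.trig_ae_mode_eq`) is bootstrapped:

* `cmodes` — `ỹ_p(t) := 𝓕θ₀(p) + ∫₀ᵗ (-4π²ν|p|² y_p - N_p(y) + 𝓕h(p))`, equal to the modes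
  `y_p(t) = 𝓕θ(t)(p)` for a.e. `t` and ALL `p` simultaneously (`ae_modes_eq_cmodes`), continuous on
  every `[0,T]` (`continuousOn_cmodes`), `ỹ_p(0) = 𝓕θ₀(p)`;
* `cmodeRHS` — the same right-hand side built on `ỹ`: continuous, a.e. equal to the original one,
  and `ỹ_p(t) = 𝓕θ₀(p) + ∫₀ᵗ cmodeRHS_p` for every `t ≥ 0`, whence
  `hasDerivAt_cmodes : ỹ_p' = cmodeRHS_p` on `(0,T)` (classical FTC);
* `bandEnergy 𝔅 Y = ∑_{p∈𝔅} ‖Y p‖²` and the **band energy identity**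
  `bandEnergy 𝔅 ỹ(T) - bandEnergy 𝔅 ỹ(0) = ∫₀ᵀ ∑_{p∈𝔅} 2⟪ỹ_p, cmodeRHS_p⟫` (`bandEnergy_sub_eq_integral`),
  with the integrand expanded in `two_inner_modeRHS`.

Supports stmt-AnomalousDissipation-0448 (the shear–drift no-go, files `Shear*`).
-/

set_option linter.dupNamespace false

noncomputable section

open scoped BigOperators Topology ENNReal NNReal InnerProductSpace ContDiff
open Filter Set Function MeasureTheory UnitAddTorus Complex

namespace Summit.AnomalousDissipation.AnomalousDissipation.Theorems.ScalarAnomalySteadySourceFormal.Negative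

open Literature.Analysis
open Literature.Analysis.FunctionSpaces Literature.Analysis.FunctionSpaces.Torus
open Literature.Analysis.FluidPDE Literature.Analysis.FluidPDE.Torus

variable {d : Type*} [Fintype d]

section Repr

variable {ν : ℝ} {S : Finset (d → ℤ)} {c : ℝ → (d → ℤ) → EuclideanSpace ℂ d}
  {u : ℝ → UnitAddTorus d → EuclideanSpace ℝ d} {h θ₀ : UnitAddTorus d → ℝ} {θ : ℝ → UnitAddTorus d → ℝ}

/-- **Continuous representatives of the modes**:
`ỹ_p(t) = 𝓕θ₀(p) + ∫₀ᵗ (-4π²ν|p|² 𝓕θ(s)(p) - N_p(s) + 𝓕h(p)) ds`. [folklore] -/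
def cmodes (ν : ℝ) (S : Finset (d → ℤ)) (c : ℝ → (d → ℤ) → EuclideanSpace ℂ d) (h θ₀ : UnitAddTorus d → ℝ)
    (θ : ℝ → UnitAddTorus d → ℝ) : ℝ → (d → ℤ) → ℂ :=
  fun t p => mFourierCoeff (fun x => (θ₀ x : ℂ)) p + ∫ s in (0 : ℝ)..t, modeRHS ν S c h (modes θ) p s

/-- `ỹ_p(0) = 𝓕θ₀(p)`. [folklore] -/
theorem cmodes_zero (p : d → ℤ) : cmodes ν S c h θ₀ θ 0 p = mFourierCoeff (fun x => (θ₀ x : ℂ)) p := by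
  simp [cmodes]

/-- **The representatives are versions of the modes**: for a.e. `t ∈ (0,T)`, `y_p(t) = ỹ_p(t)` for
all `p` at once. [folklore] -/
theorem ae_modes_eq_cmodes (hw : IsWeakScalarTransportForced ν u (fun _ => h) θ₀ θ)
    (hu : ∀ s, u s = realTrigPoly S (c s)) (hh : Integrable h volume) (hθ₀ : Integrable θ₀ volume)
    {T : ℝ} (hT : 0 < T) :
    ∀ᵐ t ∂(volume.restrict (Ioo 0 T)), ∀ p, modes θ t p = cmodes ν S c h θ₀ θ t p := by
  refine ae_all_iff.2 fun p => ?_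
  filter_upwards [trig_ae_mode_eq (hw T hT) hu hh hθ₀ p, ae_restrict_mem measurableSet_Ioo] with t ht htm
  rw [ht, cmodes, intervalIntegral.integral_of_le htm.1.le]

/-- The representatives are continuous on every `[0,T]`. [folklore] -/
theorem continuousOn_cmodes (hw : IsWeakScalarTransportForced ν u (fun _ => h) θ₀ θ)
    (hc : ∀ k, Continuous fun s => c s k) {M : ℝ} (hM : ∀ s k, ‖c s k‖ ≤ M) {T : ℝ} (hT : 0 < T) (p : d → ℤ) :
    ContinuousOn (fun t => cmodes ν S c h θ₀ θ t p) (Icc 0 T) := by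
  have hint : IntegrableOn (modeRHS ν S c h (modes θ) p) (uIcc 0 T) volume := by
    rw [uIcc_of_le hT.le, integrableOn_Icc_iff_integrableOn_Ioo]
    exact trig_integrableOn_modeRHS (hw T hT) hc hM p
  have := intervalIntegral.continuousOn_primitive_interval hint
  rw [uIcc_of_le hT.le] at this
  exact continuousOn_const.add this

/-- The modal right-hand side rebuilt on the representatives. [folklore] -/
def cmodeRHS (ν : ℝ) (S : Finset (d → ℤ)) (c : ℝ → (d → ℤ) → EuclideanSpace ℂ d) (h θ₀ : UnitAddTorus d → ℝ)
    (θ : ℝ → UnitAddTorus d → ℝ) (p : d → ℤ) (s : ℝ) : ℂ :=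
  modeRHS ν S c h (cmodes ν S c h θ₀ θ) p s

/-- The rebuilt right-hand side is a version of the original one. [folklore] -/
theorem ae_modeRHS_eq_cmodeRHS (hw : IsWeakScalarTransportForced ν u (fun _ => h) θ₀ θ)
    (hu : ∀ s, u s = realTrigPoly S (c s)) (hh : Integrable h volume) (hθ₀ : Integrable θ₀ volume)
    {T : ℝ} (hT : 0 < T) (p : d → ℤ) :
    ∀ᵐ s ∂(volume.restrict (Ioo 0 T)), modeRHS ν S c h (modes θ) p s = cmodeRHS ν S c h θ₀ θ p s := by
  filter_upwards [ae_modes_eq_cmodes hw hu hh hθ₀ hT] with s hs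
  have e : modes θ s = cmodes ν S c h θ₀ θ s := funext hs
  simp only [cmodeRHS, modeRHS, e]

/-- The rebuilt right-hand side is continuous on every `[0,T]`. [folklore] -/
theorem continuousOn_cmodeRHS (hw : IsWeakScalarTransportForced ν u (fun _ => h) θ₀ θ)
    (hc : ∀ k, Continuous fun s => c s k) {M : ℝ} (hM : ∀ s k, ‖c s k‖ ≤ M) {T : ℝ} (hT : 0 < T) (p : d → ℤ) :
    ContinuousOn (cmodeRHS ν S c h θ₀ θ p) (Icc 0 T) := by
  have hY : ∀ q, ContinuousOn (fun s => cmodes ν S c h θ₀ θ s q) (Icc 0 T) :=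
    fun q => continuousOn_cmodes hw hc hM hT q
  have hcj : ∀ k j, Continuous fun s => c s k j := fun k j => (EuclideanSpace.proj j).continuous.comp (hc k)
  unfold cmodeRHS modeRHS transportMode
  refine ((continuousOn_const.mul (hY p)).sub (continuousOn_const.mul
    (continuousOn_finsetSum _ fun k _ => ?_))).add continuousOn_const
  refine ((continuousOn_finsetSum _ fun j _ => ?_).mul (hY (p - k))).add
    ((continuousOn_finsetSum _ fun j _ => ?_).mul (hY (p + k)))
  · exact (continuous_const.mul (hcj k j)).continuousOn
  · exact (continuous_const.mul (Complex.continuous_conj.comp (hcj k j))).continuousOn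

/-- **Integral equation with continuous integrand**: `ỹ_p(t) = 𝓕θ₀(p) + ∫₀ᵗ cmodeRHS_p` on `[0,T]`. [folklore] -/
theorem cmodes_eq_integral (hw : IsWeakScalarTransportForced ν u (fun _ => h) θ₀ θ)
    (hu : ∀ s, u s = realTrigPoly S (c s)) (hh : Integrable h volume) (hθ₀ : Integrable θ₀ volume)
    {T : ℝ} (hT : 0 < T) {t : ℝ} (ht : t ∈ Icc 0 T) (p : d → ℤ) :
    cmodes ν S c h θ₀ θ t p =
      mFourierCoeff (fun x => (θ₀ x : ℂ)) p + ∫ s in (0 : ℝ)..t, cmodeRHS ν S c h θ₀ θ p s := by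
  have hT1 : 0 < T + 1 := by linarith
  have hae := ae_modeRHS_eq_cmodeRHS hw hu hh hθ₀ hT1 p
  rw [cmodes]
  congr 1
  refine intervalIntegral.integral_congr_ae ?_
  have hsub : ∀ᵐ s ∂(volume : Measure ℝ), s ∈ Ioo 0 (T + 1) → _ := (ae_restrict_iff' measurableSet_Ioo).1 hae
  filter_upwards [hsub] with s hs hsI
  rw [uIoc_of_le ht.1] at hsI
  exact hs ⟨hsI.1, lt_of_le_of_lt hsI.2 (by linarith [ht.2])⟩

/-- **The representatives are `C¹`**: `ỹ_p'(t) = cmodeRHS_p(t)` for `t ∈ (0,T)`. [folklore] -/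
theorem hasDerivAt_cmodes (hw : IsWeakScalarTransportForced ν u (fun _ => h) θ₀ θ)
    (hu : ∀ s, u s = realTrigPoly S (c s)) (hh : Integrable h volume) (hθ₀ : Integrable θ₀ volume)
    (hc : ∀ k, Continuous fun s => c s k) {M : ℝ} (hM : ∀ s k, ‖c s k‖ ≤ M)
    {T : ℝ} (hT : 0 < T) {t : ℝ} (ht : t ∈ Ioo 0 T) (p : d → ℤ) :
    HasDerivAt (fun s => cmodes ν S c h θ₀ θ s p) (cmodeRHS ν S c h θ₀ θ p t) t := by
  have hG := continuousOn_cmodeRHS (S := S) hw hc hM hT p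
  have hΦ : HasDerivAt (fun s => mFourierCoeff (fun x => (θ₀ x : ℂ)) p +
      ∫ r in (0 : ℝ)..s, cmodeRHS ν S c h θ₀ θ p r) (cmodeRHS ν S c h θ₀ θ p t) t := by
    refine (intervalIntegral.integral_hasDerivAt_right ?_ ?_ ?_).const_add _
    · exact (hG.mono (Icc_subset_Icc_right ht.2.le)).intervalIntegrable_of_Icc ht.1.le
    · exact (hG.mono Ioo_subset_Icc_self).stronglyMeasurableAtFilter isOpen_Ioo _ ht
    · exact hG.continuousAt (Icc_mem_nhds ht.1 ht.2)
  refine hΦ.congr_of_eventuallyEq ?_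
  filter_upwards [Icc_mem_nhds ht.1 ht.2] with s hs
  exact cmodes_eq_integral hw hu hh hθ₀ hT hs p

/-- The energy carried by a finite set of modes: `∑_{p∈𝔅} ‖Y p‖²`. [folklore] -/
def bandEnergy (𝔅 : Finset (d → ℤ)) (Y : (d → ℤ) → ℂ) : ℝ :=
  ∑ p ∈ 𝔅, ‖Y p‖ ^ 2

omit [Fintype d] in
/-- `bandEnergy ≥ 0`. [folklore] -/
theorem bandEnergy_nonneg (𝔅 : Finset (d → ℤ)) (Y : (d → ℤ) → ℂ) : 0 ≤ bandEnergy 𝔅 Y :=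
  Finset.sum_nonneg fun _ _ => sq_nonneg _

/-- The band energy of the representatives is differentiable on `(0,T)`. [folklore] -/
theorem hasDerivAt_bandEnergy (hw : IsWeakScalarTransportForced ν u (fun _ => h) θ₀ θ)
    (hu : ∀ s, u s = realTrigPoly S (c s)) (hh : Integrable h volume) (hθ₀ : Integrable θ₀ volume)
    (hc : ∀ k, Continuous fun s => c s k) {M : ℝ} (hM : ∀ s k, ‖c s k‖ ≤ M)
    {T : ℝ} (hT : 0 < T) {t : ℝ} (ht : t ∈ Ioo 0 T) (𝔅 : Finset (d → ℤ)) :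
    HasDerivAt (fun s => bandEnergy 𝔅 (cmodes ν S c h θ₀ θ s))
      (∑ p ∈ 𝔅, 2 * ⟪cmodes ν S c h θ₀ θ t p, cmodeRHS ν S c h θ₀ θ p t⟫_ℝ) t := by
  unfold bandEnergy
  exact HasDerivAt.fun_sum fun p _ => (hasDerivAt_cmodes hw hu hh hθ₀ hc hM hT ht p).norm_sq

/-- **Band energy identity** on `[0,T]`:
`∑_{p∈𝔅} ‖ỹ_p(T)‖² - ∑_{p∈𝔅} ‖𝓕θ₀(p)‖² = ∫₀ᵀ ∑_{p∈𝔅} 2⟪ỹ_p, cmodeRHS_p⟫`. [folklore] -/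
theorem bandEnergy_sub_eq_integral (hw : IsWeakScalarTransportForced ν u (fun _ => h) θ₀ θ)
    (hu : ∀ s, u s = realTrigPoly S (c s)) (hh : Integrable h volume) (hθ₀ : Integrable θ₀ volume)
    (hc : ∀ k, Continuous fun s => c s k) {M : ℝ} (hM : ∀ s k, ‖c s k‖ ≤ M)
    {T : ℝ} (hT : 0 < T) (𝔅 : Finset (d → ℤ)) :
    bandEnergy 𝔅 (cmodes ν S c h θ₀ θ T) - bandEnergy 𝔅 (cmodes ν S c h θ₀ θ 0) =
      ∫ t in (0 : ℝ)..T, ∑ p ∈ 𝔅, 2 * ⟪cmodes ν S c h θ₀ θ t p, cmodeRHS ν S c h θ₀ θ p t⟫_ℝ := by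
  have hY : ∀ q, ContinuousOn (fun s => cmodes ν S c h θ₀ θ s q) (Icc 0 T) :=
    fun q => continuousOn_cmodes hw hc hM hT q
  have hG : ∀ q, ContinuousOn (cmodeRHS ν S c h θ₀ θ q) (Icc 0 T) := fun q => continuousOn_cmodeRHS hw hc hM hT q
  symm
  refine intervalIntegral.integral_eq_sub_of_hasDerivAt_of_le hT.le ?_
    (fun t ht => hasDerivAt_bandEnergy hw hu hh hθ₀ hc hM hT ht 𝔅) ?_
  · unfold bandEnergy
    exact continuousOn_finsetSum _ fun p _ => ((hY p).norm).pow 2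
  · refine ContinuousOn.intervalIntegrable_of_Icc hT.le ?_
    exact continuousOn_finsetSum _ fun p _ => continuousOn_const.mul ((hY p).inner (hG p))

/-- The integrand of the band identity, expanded:
`2⟪Y, -aY - N + H⟫ = -2a‖Y‖² - 2 Re(N conj Y) + 2 Re(H conj Y)` (`a` real). [folklore] -/
theorem two_inner_modeRHS (a : ℝ) (Y N H : ℂ) :
    2 * ⟪Y, -(a : ℂ) * Y - N + H⟫_ℝ =
      -2 * a * ‖Y‖ ^ 2 - 2 * (N * (starRingEnd ℂ) Y).re + 2 * (H * (starRingEnd ℂ) Y).re := by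
  rw [Complex.inner]
  have hY : Y * (starRingEnd ℂ) Y = ((‖Y‖ ^ 2 : ℝ) : ℂ) := by
    rw [Complex.mul_conj, Complex.normSq_eq_norm_sq]
  have e : (-(a : ℂ) * Y - N + H) * (starRingEnd ℂ) Y =
      -((a : ℂ) * ((‖Y‖ ^ 2 : ℝ) : ℂ)) - N * (starRingEnd ℂ) Y + H * (starRingEnd ℂ) Y := by
    rw [← hY]; ring
  rw [e]
  simp only [Complex.sub_re, Complex.add_re, Complex.neg_re, Complex.mul_re, Complex.ofReal_re,
    Complex.ofReal_im, mul_zero, sub_zero]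
  ring

end Repr

end Summit.AnomalousDissipation.AnomalousDissipation.Theorems.ScalarAnomalySteadySourceFormal.Negative
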